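import Summits.CriticalPhenomena.PercolationContinuityZ3.Theorems.Transplant.FKConnectivityAllQForestAdjacentPathGadgetTransferA
import Summits.CriticalPhenomena.PercolationContinuityZ3.Theorems.Transplant.FKConnectivityAllQForestAdjacentPathGadgetTransferB
import Summits.CriticalPhenomena.PercolationContinuityZ3.Theorems.Transplant.FKConnectivityAllQForestAdjacentSeparatorResidual
import HarnessLib

/-!
# The path gadget: the residual of the node localises on the doubly-`pq` colourings

builds on p205010 (kernel theorem, internal audit signed; external expert review pending).  No definitions, no named facts, no sorries;
standard axioms.

Separator `S = {o, p, q}` with the PATH gadget `{op, oq}` (memo bschramm/FROM-fk-1-g20-SEPARATOR-EXCHANGE.md §3).  By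
`adjForestNoSq_fibre_residual` (`…SeparatorResidual`) the node's two fibre counts differ by the difference of their RESIDUAL parts
(`R` = both sides trace-asymmetric); by the involution `Ψ` of `…PathGadgetTransfer` the residual parts differ by the difference of
their DOUBLY-`pq` parts (`Res` = `pq` joined on both sides in opposite classes):
* **`adjForestNoSq_fibre_pathGadget_residual`** — `#(bad ∩ R) + #(good ∩ R ∩ Res) = #(good ∩ R) + #(bad ∩ R ∩ Res)`.
So across a path-gadget separator the node's inequality is EQUIVALENT to `bad_{R∩Res} ≤ good_{R∩Res}`; `R ∩ Res` consists of the four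
product classes `(d,pq | pq,d)`, `(pq,d | d,pq)` × two gadget orientations, on which `bad − good = −2·x₁(d,pq)·x₂(d,pq)` (memo §3) —
the kernel form of the rank-one identity up to the product decomposition, which is left to a successor.
[cite: Grimmett2006, §3.8 (pp. 61–62); §4.2 Lemma (4.13)] [cite: SempleWelsh2008, Conj. 1.1 (p. 2)] [cite: Linusson2011, Prop. 2.6]
-/

noncomputable section

namespace Summit.CriticalPhenomena.PercolationContinuityZ3.Theorems

namespace FK

open Set SimpleGraph Literature.Probability.LatticeModels Literature.Probability.Percolation
open scoped Classical

variable {V : Type*} [Fintype V]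

section PathGadgetResidual

open scoped symmDiff

variable {E₁ E₂ : Set (Sym2 V)} {V₁ V₂ : Set V} {M u₀ : BondConfig V} {o p q v y : V}

/-- **The second involution `Ψ` on the residual colourings of a path-gadget separator** (both cases; see
`forest_pair_pathGadget_transfer_of_mem`). [cite: Grimmett2006, §3.8 (pp. 61–62); §4.2 Lemma (4.13)] [cite: Linusson2011, Prop. 2.6] -/
theorem forest_pair_pathGadget_transfer (hop : o ≠ p) (hoq : o ≠ q) (hpq : p ≠ q)
    (h₁ : ∀ e ∈ E₁, ∀ z ∈ e, z ∈ V₁) (h₂ : ∀ e ∈ E₂, ∀ z ∈ e, z ∈ V₂) (hS : V₁ ∩ V₂ ⊆ ({o, p, q} : Set V))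
    (hd : Disjoint E₁ E₂) (hn₁ : ∀ x ∈ ({o, p, q} : Set V), ∀ x' ∈ ({o, p, q} : Set V), s(x, x') ∉ E₁)
    (hn₂ : ∀ x ∈ ({o, p, q} : Set V), ∀ x' ∈ ({o, p, q} : Set V), s(x, x') ∉ E₂)
    {M' : BondConfig V} (hM' : M' ∪ u₀ ⊆ ({s(o, p), s(o, q)} : Set (Sym2 V)) ∪ (E₁ ∪ E₂)) (hgp : s(o, p) ∈ M') (hgq : s(o, q) ∈ M')
    (Ψ : BondConfig V → BondConfig V)
    (hΨ : ∀ ω, Ψ ω =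
      if s(o, p) ∈ ω then
        (if s(o, q) ∈ ω then
          (if ¬ (openGraph ((ω ∆ M') ∩ E₁)).Reachable o q ∧ ¬ (openGraph ((ω ∆ M') ∩ E₂)).Reachable o p
            then ω ∆ (M' ∩ E₂ ∪ {s(o, q)}) else ω ∆ (M' ∩ E₂ ∪ {s(o, p)}))
        else
          (if ∀ x ∈ ({o, p, q} : Set V), ∀ x' ∈ ({o, p, q} : Set V), (openGraph (ω ∩ E₁)).Reachable x x' → x = x'
            then ω ∆ (M' ∩ E₂ ∪ {s(o, q)}) else ω ∆ (M' ∩ E₂ ∪ {s(o, p)})))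
      else
        (if s(o, q) ∈ ω then
          (if ∀ x ∈ ({o, p, q} : Set V), ∀ x' ∈ ({o, p, q} : Set V), (openGraph (ω ∩ E₁)).Reachable x x' → x = x'
            then ω ∆ (M' ∩ E₂ ∪ {s(o, p)}) else ω ∆ (M' ∩ E₂ ∪ {s(o, q)}))
        else
          (if ¬ (openGraph (ω ∩ E₁)).Reachable o p ∧ ¬ (openGraph (ω ∩ E₂)).Reachable o q
            then ω ∆ (M' ∩ E₂ ∪ {s(o, p)}) else ω ∆ (M' ∩ E₂ ∪ {s(o, q)}))))
    {ω : BondConfig V} (hω : ω \ M' = u₀) (hF : IsForestCfg ω) (hFB : IsForestCfg (ω ∆ M'))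
    (hR₁ : ¬ ∀ x ∈ ({o, p, q} : Set V), ∀ x' ∈ ({o, p, q} : Set V),
      (openGraph (ω ∩ E₁)).Reachable x x' ↔ (openGraph ((ω ∆ M') ∩ E₁)).Reachable x x')
    (hR₂ : ¬ ∀ x ∈ ({o, p, q} : Set V), ∀ x' ∈ ({o, p, q} : Set V),
      (openGraph (ω ∩ E₂)).Reachable x x' ↔ (openGraph ((ω ∆ M') ∩ E₂)).Reachable x x')
    (hnRes : ¬ (((openGraph (ω ∩ E₂)).Reachable p q ∧ (openGraph ((ω ∆ M') ∩ E₁)).Reachable p q) ∨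
      ((openGraph (ω ∩ E₁)).Reachable p q ∧ (openGraph ((ω ∆ M') ∩ E₂)).Reachable p q))) :
    Ψ ω \ M' = u₀ ∧ IsForestCfg (Ψ ω) ∧ IsForestCfg ((Ψ ω) ∆ M') ∧ Ψ (Ψ ω) = ω ∧
      (∀ x ∈ E₁, x ∈ Ψ ω ↔ x ∈ ω) ∧ (∀ x ∈ M', x ∈ E₂ → (x ∈ Ψ ω ↔ x ∉ ω)) ∧
      (¬ ∀ x ∈ ({o, p, q} : Set V), ∀ x' ∈ ({o, p, q} : Set V),
        (openGraph ((Ψ ω) ∩ E₁)).Reachable x x' ↔ (openGraph (((Ψ ω) ∆ M') ∩ E₁)).Reachable x x') ∧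
      (¬ ∀ x ∈ ({o, p, q} : Set V), ∀ x' ∈ ({o, p, q} : Set V),
        (openGraph ((Ψ ω) ∩ E₂)).Reachable x x' ↔ (openGraph (((Ψ ω) ∆ M') ∩ E₂)).Reachable x x') ∧
      ¬ (((openGraph ((Ψ ω) ∩ E₂)).Reachable p q ∧ (openGraph (((Ψ ω) ∆ M') ∩ E₁)).Reachable p q) ∨
        ((openGraph ((Ψ ω) ∩ E₁)).Reachable p q ∧ (openGraph (((Ψ ω) ∆ M') ∩ E₂)).Reachable p q)) := by
  by_cases hp : s(o, p) ∈ ω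
  · exact forest_pair_pathGadget_transfer_of_mem hop hoq hpq h₁ h₂ hS hd hn₁ hn₂ hM' hgp hgq Ψ hΨ hω hF hFB hR₁ hR₂ hnRes hp
  · exact forest_pair_pathGadget_transfer_of_not_mem hop hoq hpq h₁ h₂ hS hd hn₁ hn₂ hM' hgp hgq Ψ hΨ hω hF hFB hR₁ hR₂ hnRes hp

/-- **The residual of a path-gadget separator localises on the doubly-`pq` colourings.**  Fibre `(M ∪ {e, f}, u₀)`, `e = ov ∈ E₁`,
`f = oy ∈ E₂`, geometry of `forest_pair_pathGadget_transfer`; `R` = the residual colourings (both sides trace-asymmetric), `Res` = the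
doubly-`pq` ones.  Then `#(bad ∩ R) + #(good ∩ R ∩ Res) = #(good ∩ R) + #(bad ∩ R ∩ Res)`, i.e. `bad_R − good_R = bad_{R∩Res} − good_{R∩Res}`;
with `adjForestNoSq_fibre_residual` (`bad − good = bad_R − good_R`) the node's inequality across the separator is equivalent to
`bad_{R∩Res} ≤ good_{R∩Res}` (memo §3: these are four product classes, and the difference is `−2·x₁(d,pq)·x₂(d,pq)`).
[cite: SempleWelsh2008, Conj. 1.1 (p. 2)] [cite: Linusson2011, Prop. 2.6] [cite: Grimmett2006, §3.8 (pp. 61–62)] -/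
theorem adjForestNoSq_fibre_pathGadget_residual (hop : o ≠ p) (hoq : o ≠ q) (hpq : p ≠ q)
    (h₁ : ∀ e ∈ E₁, ∀ z ∈ e, z ∈ V₁) (h₂ : ∀ e ∈ E₂, ∀ z ∈ e, z ∈ V₂) (hS : V₁ ∩ V₂ ⊆ ({o, p, q} : Set V))
    (hd : Disjoint E₁ E₂) (hn₁ : ∀ x ∈ ({o, p, q} : Set V), ∀ x' ∈ ({o, p, q} : Set V), s(x, x') ∉ E₁)
    (hn₂ : ∀ x ∈ ({o, p, q} : Set V), ∀ x' ∈ ({o, p, q} : Set V), s(x, x') ∉ E₂)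
    (heE : s(o, v) ∈ E₁) (hfE : s(o, y) ∈ E₂)
    (hM' : insert s(o, y) (insert s(o, v) M) ∪ u₀ ⊆ ({s(o, p), s(o, q)} : Set (Sym2 V)) ∪ (E₁ ∪ E₂))
    (hgp : s(o, p) ∈ insert s(o, y) (insert s(o, v) M)) (hgq : s(o, q) ∈ insert s(o, y) (insert s(o, v) M))
    (Rset Res : Set (BondConfig V))
    (hRset : ∀ ω, ω ∈ Rset ↔
      ((¬ ∀ x ∈ ({o, p, q} : Set V), ∀ x' ∈ ({o, p, q} : Set V),
        (openGraph (ω ∩ E₁)).Reachable x x' ↔ (openGraph ((ω ∆ insert s(o, y) (insert s(o, v) M)) ∩ E₁)).Reachable x x') ∧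
      (¬ ∀ x ∈ ({o, p, q} : Set V), ∀ x' ∈ ({o, p, q} : Set V),
        (openGraph (ω ∩ E₂)).Reachable x x' ↔ (openGraph ((ω ∆ insert s(o, y) (insert s(o, v) M)) ∩ E₂)).Reachable x x')))
    (hRes : ∀ ω, ω ∈ Res ↔
      (((openGraph (ω ∩ E₂)).Reachable p q ∧ (openGraph ((ω ∆ insert s(o, y) (insert s(o, v) M)) ∩ E₁)).Reachable p q) ∨
      ((openGraph (ω ∩ E₁)).Reachable p q ∧ (openGraph ((ω ∆ insert s(o, y) (insert s(o, v) M)) ∩ E₂)).Reachable p q))) :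
    fibreCount (insert s(o, y) (insert s(o, v) M)) u₀ (forestEv V ∩ {ω | s(o, v) ∈ ω ∧ s(o, y) ∈ ω} ∩ Rset) (forestEv V) +
      fibreCount (insert s(o, y) (insert s(o, v) M)) u₀ (forestEv V ∩ {ω | s(o, v) ∈ ω} ∩ (Rset ∩ Res)) (forestEv V ∩ {ω | s(o, y) ∈ ω}) =
    fibreCount (insert s(o, y) (insert s(o, v) M)) u₀ (forestEv V ∩ {ω | s(o, v) ∈ ω} ∩ Rset) (forestEv V ∩ {ω | s(o, y) ∈ ω}) +
      fibreCount (insert s(o, y) (insert s(o, v) M)) u₀ (forestEv V ∩ {ω | s(o, v) ∈ ω ∧ s(o, y) ∈ ω} ∩ (Rset ∩ Res)) (forestEv V) := by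
  set M' : BondConfig V := insert s(o, y) (insert s(o, v) M) with hM'def
  -- split along `Res`
  have splitA : ∀ (A B : Set (BondConfig V)), fibreCount M' u₀ (A ∩ Rset) B =
      fibreCount M' u₀ (A ∩ (Rset ∩ Resᶜ)) B + fibreCount M' u₀ (A ∩ (Rset ∩ Res)) B := by
    intro A B
    rw [← fibreCount_split_left M' u₀ B (Set.disjoint_of_subset inter_subset_right inter_subset_right
      (Set.disjoint_of_subset inter_subset_right inter_subset_right disjoint_compl_left)), ← inter_union_distrib_left,
      ← inter_union_distrib_left, compl_union_self, inter_univ]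
  -- the involution `Ψ` on `R ∖ Res`
  set Ψ : BondConfig V → BondConfig V := fun ω =>
      if s(o, p) ∈ ω then
        (if s(o, q) ∈ ω then
          (if ¬ (openGraph ((ω ∆ M') ∩ E₁)).Reachable o q ∧ ¬ (openGraph ((ω ∆ M') ∩ E₂)).Reachable o p
            then ω ∆ (M' ∩ E₂ ∪ {s(o, q)}) else ω ∆ (M' ∩ E₂ ∪ {s(o, p)}))
        else
          (if ∀ x ∈ ({o, p, q} : Set V), ∀ x' ∈ ({o, p, q} : Set V), (openGraph (ω ∩ E₁)).Reachable x x' → x = x'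
            then ω ∆ (M' ∩ E₂ ∪ {s(o, q)}) else ω ∆ (M' ∩ E₂ ∪ {s(o, p)})))
      else
        (if s(o, q) ∈ ω then
          (if ∀ x ∈ ({o, p, q} : Set V), ∀ x' ∈ ({o, p, q} : Set V), (openGraph (ω ∩ E₁)).Reachable x x' → x = x'
            then ω ∆ (M' ∩ E₂ ∪ {s(o, p)}) else ω ∆ (M' ∩ E₂ ∪ {s(o, q)}))
        else
          (if ¬ (openGraph (ω ∩ E₁)).Reachable o p ∧ ¬ (openGraph (ω ∩ E₂)).Reachable o q
            then ω ∆ (M' ∩ E₂ ∪ {s(o, p)}) else ω ∆ (M' ∩ E₂ ∪ {s(o, q)}))) with hΨdef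
  have hΨ : ∀ ω, Ψ ω =
      if s(o, p) ∈ ω then
        (if s(o, q) ∈ ω then
          (if ¬ (openGraph ((ω ∆ M') ∩ E₁)).Reachable o q ∧ ¬ (openGraph ((ω ∆ M') ∩ E₂)).Reachable o p
            then ω ∆ (M' ∩ E₂ ∪ {s(o, q)}) else ω ∆ (M' ∩ E₂ ∪ {s(o, p)}))
        else
          (if ∀ x ∈ ({o, p, q} : Set V), ∀ x' ∈ ({o, p, q} : Set V), (openGraph (ω ∩ E₁)).Reachable x x' → x = x'
            then ω ∆ (M' ∩ E₂ ∪ {s(o, q)}) else ω ∆ (M' ∩ E₂ ∪ {s(o, p)})))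
      else
        (if s(o, q) ∈ ω then
          (if ∀ x ∈ ({o, p, q} : Set V), ∀ x' ∈ ({o, p, q} : Set V), (openGraph (ω ∩ E₁)).Reachable x x' → x = x'
            then ω ∆ (M' ∩ E₂ ∪ {s(o, p)}) else ω ∆ (M' ∩ E₂ ∪ {s(o, q)}))
        else
          (if ¬ (openGraph (ω ∩ E₁)).Reachable o p ∧ ¬ (openGraph (ω ∩ E₂)).Reachable o q
            then ω ∆ (M' ∩ E₂ ∪ {s(o, p)}) else ω ∆ (M' ∩ E₂ ∪ {s(o, q)}))) := fun ω => rfl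
  have hfM : s(o, y) ∈ M' := mem_insert _ _
  have hfB : ∀ X : BondConfig V, s(o, y) ∈ X ∆ M' ↔ s(o, y) ∉ X := fun X => mem_symmDiff_iff_of_mem hfM
  have step : ∀ ω, ω \ M' = u₀ → IsForestCfg ω → IsForestCfg (ω ∆ M') → ω ∈ Rset ∩ Resᶜ →
      Ψ ω \ M' = u₀ ∧ IsForestCfg (Ψ ω) ∧ IsForestCfg ((Ψ ω) ∆ M') ∧ Ψ (Ψ ω) = ω ∧
      (∀ x ∈ E₁, x ∈ Ψ ω ↔ x ∈ ω) ∧ (∀ x ∈ M', x ∈ E₂ → (x ∈ Ψ ω ↔ x ∉ ω)) ∧ Ψ ω ∈ Rset ∩ Resᶜ := by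
    intro ω hω hF hFB hmem
    obtain ⟨hRω, hResω⟩ := hmem
    obtain ⟨hR₁, hR₂⟩ := (hRset ω).1 hRω
    have hnRes : ¬ _ := fun h => hResω ((hRes ω).2 h)
    obtain ⟨hfib, hF1, hF2, hinv, hE1, hE2, hR₁', hR₂', hnRes'⟩ :=
      forest_pair_pathGadget_transfer hop hoq hpq h₁ h₂ hS hd hn₁ hn₂ hM' hgp hgq Ψ hΨ hω hF hFB hR₁ hR₂ hnRes
    exact ⟨hfib, hF1, hF2, hinv, hE1, hE2, (hRset _).2 ⟨hR₁', hR₂'⟩, fun h => hnRes' ((hRes _).1 h)⟩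
  have hbij : fibreCount M' u₀ (forestEv V ∩ {ω | s(o, v) ∈ ω ∧ s(o, y) ∈ ω} ∩ (Rset ∩ Resᶜ)) (forestEv V) =
      fibreCount M' u₀ (forestEv V ∩ {ω | s(o, v) ∈ ω} ∩ (Rset ∩ Resᶜ)) (forestEv V ∩ {ω | s(o, y) ∈ ω}) := by
    refine fibreCount_eq_of_bij Ψ Ψ (fun ω hω hA hB => ?_) (fun ω hω hA hB => ?_)
    · obtain ⟨⟨hF, he, hf⟩, hmem⟩ := hA
      have hF' : IsForestCfg ω := hF
      have hFB : IsForestCfg (ω ∆ M') := hB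
      obtain ⟨hfib, hF1, hF2, hinv, hE1, hE2, hmem'⟩ := step ω hω hF' hFB hmem
      refine ⟨hfib, ⟨⟨hF1, (hE1 _ heE).2 he⟩, hmem'⟩, ⟨hF2, ?_⟩, hinv⟩
      show s(o, y) ∈ (Ψ ω) ∆ M'
      rw [hfB, hE2 _ hfM hfE, not_not]; exact hf
    · obtain ⟨⟨hF, he⟩, hmem⟩ := hA
      obtain ⟨hFB, hf⟩ := hB
      have hF' : IsForestCfg ω := hF
      have hFB' : IsForestCfg (ω ∆ M') := hFB
      obtain ⟨hfib, hF1, hF2, hinv, hE1, hE2, hmem'⟩ := step ω hω hF' hFB' hmem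
      have hfω : s(o, y) ∉ ω := (hfB ω).1 hf
      exact ⟨hfib, ⟨⟨hF1, (hE1 _ heE).2 he, (hE2 _ hfM hfE).2 hfω⟩, hmem'⟩, hF2, hinv⟩
  rw [splitA (forestEv V ∩ {ω | s(o, v) ∈ ω ∧ s(o, y) ∈ ω}) (forestEv V),
    splitA (forestEv V ∩ {ω | s(o, v) ∈ ω}) (forestEv V ∩ {ω | s(o, y) ∈ ω}), hbij]
  ring

end PathGadgetResidual

end FK

end Summit.CriticalPhenomena.PercolationContinuityZ3.Theorems

end
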